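import Summits.RiemannHypothesis.RiemannHypothesis.Theorems.HandoffDecompositionConsequences
import HarnessLib

/-!
# The TAIL DICHOTOMY for per-window statements of the handoff decomposition (vacuity vs. cumulativity), in general form

Cell `rh-explicit`, TRACK «HANDOFF», seat handoff-theory-1 (definitions + logic), gen2.  Companion text:
`HOME/handoff/HANDOFF-STATEMENT.md` §I.5 «THE ABSTRACT FORM» (v1.4).  Builds on this seat's
`HandoffDecomposition{,Consequences}.lean`; generalises `exists_forall_handoffStep` (the vacuity trap, `X = HandoffStep`)
and `HandoffCouplingCumulative.forall_handoffH_of_exists_forall_handoffCoupling` (cumulativity, `X = Coupling`).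

HONEST FRAMING.  Nothing here is a step towards RH.  This is a two-lemma TOOL for whoever proposes the next per-window
«structure» statement `X q` intended to be proved «for all primes q ≥ q₀»:

* `exists_forall_of_vacuous` — if `X` is RH-implied and is implied by the FAILURE of the induction hypothesis
  (`¬ WeilPositivityOn((log q)/2) → X q`), then `∃ q₀, ∀ primes q ≥ q₀, X q` is an unconditional THEOREM (excluded
  middle) — so proving it carries no information (VACUITY);
* `forall_handoffH_of_exists_forall_of_cumulative` / `riemannHypothesis_iff_exists_forall_of_cumulative` — if `X` is
  RH-implied and CUMULATIVE (`X q → WeilPositivityOn((log q)/2)`), then its tail form `∃ q₀, ∀ primes q ≥ q₀, X q` is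
  ALREADY equivalent to RH — so «for large q» is no discount.
A statement escaping both must say something non-trivial about the indefinite regime of the old form without asserting
positivity (HANDOFF-STATEMENT §I.5).

References: Yoshida 1992 Prop. 6 (threshold) [Yoshida1992HermitianForms]; Bombieri 2000 Thm 2 [Bombieri2000Weil].
-/

set_option linter.dupNamespace false  -- the mandated namespace repeats `RiemannHypothesis`

noncomputable section

open Set Literature.NumberTheory.LFunctions

namespace Summit.RiemannHypothesis.RiemannHypothesis.Theorems.HandoffDecomposition

variable {X : ℕ → Prop}

/-- **VACUITY.**  An RH-implied per-window statement that is implied by the FAILURE of the induction hypothesis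
`WeilPositivityOn((log q)/2)` holds for all sufficiently large primes — unconditionally, by excluded middle (under RH by
the first hypothesis; under `¬RH` the induction hypothesis fails at every prime past the first failing window,
`exists_first_failure_of_not_riemannHypothesis`).  Instance: `X = HandoffStep` (`exists_forall_handoffStep`).
[cite: Yoshida1992HermitianForms, Prop. 6 (p. 320); this track (theory-1 gen2)] -/
theorem exists_forall_of_vacuous (hRH : Summit.RiemannHypothesis → ∀ q : ℕ, q.Prime → X q)
    (hvac : ∀ q : ℕ, q.Prime → ¬ WeilPositivityOn (Real.log q / 2) → X q) :
    ∃ q₀ : ℕ, ∀ q : ℕ, q.Prime → q₀ ≤ q → X q := by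
  by_cases h : Summit.RiemannHypothesis
  · exact ⟨0, fun q hq _ ↦ hRH h q hq⟩
  · obtain ⟨q₁, hq₁, -, -, hfail⟩ := exists_first_failure_of_not_riemannHypothesis h
    refine ⟨nextPrime q₁, fun q hq hle ↦ hvac q hq fun hpos ↦ hfail q₁ hq₁ le_rfl ?_⟩
    -- positivity on `C((log q)/2)` with `q ≥ q₁⁺` would give `H q₁`
    rw [handoffH_iff_weilPositivityOn hq₁]
    refine hpos.mono ?_
    have h1 : (nextPrime q₁ : ℝ) ≤ q := by exact_mod_cast hle
    have h2 := Real.log_le_log (by exact_mod_cast (nextPrime_prime q₁).pos) h1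
    linarith

/-- **CUMULATIVITY.**  If a per-window statement is CUMULATIVE — `X q → WeilPositivityOn((log q)/2)` for every prime
`q` — then its TAIL form already gives every `H(q)`: every window lies below some large prime.  Instances: `X q =
HandoffH q`, `Handoff.HandoffCoupling q q⁺ η`, `HandoffCouplingPos q q⁺ η`. [cite: Bombieri2000Weil, Thm. 2; this track (theory-1 gen2)] -/
theorem forall_handoffH_of_exists_forall_of_cumulative
    (hcum : ∀ q : ℕ, q.Prime → X q → WeilPositivityOn (Real.log q / 2))
    (htail : ∃ q₀ : ℕ, ∀ q : ℕ, q.Prime → q₀ ≤ q → X q) :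
    ∀ q : ℕ, q.Prime → HandoffH q := by
  obtain ⟨q₀, h⟩ := htail
  intro P hP
  obtain ⟨q, hqge, hq⟩ := Nat.exists_infinite_primes (max q₀ (nextPrime P))
  have hW := hcum q hq (h q hq ((le_max_left _ _).trans hqge))
  rw [handoffH_iff_weilPositivityOn hP]
  refine hW.mono ?_
  have h1 : (nextPrime P : ℝ) ≤ q := by exact_mod_cast (le_max_right _ _).trans hqge
  have h0 : (0 : ℝ) < nextPrime P := by exact_mod_cast (nextPrime_prime P).pos
  linarith [Real.log_le_log h0 h1]

/-- **The tail form of an RH-implied CUMULATIVE statement is RH** — no asymptotic discount.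
[cite: Bombieri2000Weil, Thm. 2; this track (theory-1 gen2)] -/
theorem riemannHypothesis_iff_exists_forall_of_cumulative (hRH : Summit.RiemannHypothesis → ∀ q : ℕ, q.Prime → X q)
    (hcum : ∀ q : ℕ, q.Prime → X q → WeilPositivityOn (Real.log q / 2)) :
    Summit.RiemannHypothesis ↔ ∃ q₀ : ℕ, ∀ q : ℕ, q.Prime → q₀ ≤ q → X q := by
  refine ⟨fun h ↦ ⟨0, fun q hq _ ↦ hRH h q hq⟩, fun h ↦ ?_⟩
  rw [riemannHypothesis_iff_forall_handoffH]
  exact forall_handoffH_of_exists_forall_of_cumulative hcum h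

/-- **The two traps exclude each other window by window**: if BOTH `¬IH(q) → X q` and `X q → IH(q)` hold at a prime
`q`, then `IH(q) = WeilPositivityOn((log q)/2)` holds outright (so today this can be the case only where the rung is a
theorem). [folklore] -/
theorem weilPositivityOn_of_vacuous_of_cumulative {q : ℕ}
    (hvac : ¬ WeilPositivityOn (Real.log q / 2) → X q) (hcum : X q → WeilPositivityOn (Real.log q / 2)) :
    WeilPositivityOn (Real.log q / 2) := by
  by_contra h
  exact h (hcum (hvac h))

end Summit.RiemannHypothesis.RiemannHypothesis.Theorems.HandoffDecomposition

end
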